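import Summits.HodgeConjecture.CorCM.AbelianTwoPowerAtomsThirtyTwo
import Summits.HodgeConjecture.CorCM.AbelianTwoGroupAtomEmbedding
import Summits.HodgeConjecture.CorCM.GaloisOcticSimpleCMFourfolds
import HarnessLib

/-!
# THE CLASSIFICATION of the abelian CM fields of `2`-power degree all of whose simple CM abelian varieties are
# nondegenerate

COR-CM (cell `pub-hodgecm2`), binder seat b04 (gen 16), count-neutral claim ABELIAN-2POWER-NECESSITY, part IV.
KERNEL ONLY: theorems; no definition, no named fact, no `sorry`.  `HC_CM` is neither used nor claimed.

**Theorem (`forall_isPrimitive_isNondegenerate_iff`).**  Let `K` be a CM field, Galois over `ℚ` with ABELIAN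
Galois group of order `[K:ℚ] = 2^{n+1}`, `c` = complex conjugation.  Every PRIMITIVE CM type of `K` is NONDEGENERATE
(equivalently: every SIMPLE abelian variety with complex multiplication by `K` is nondegenerate —
`forall_isSimple_isNondegenerate_iff`) **if and only if** one of

* (α) `c` lies in a cyclic subgroup of `Gal(K/ℚ)` of index `≤ 2` (`K` cyclic over `ℚ` or over a real quadratic
  field — gen 15, `ThinKernel`),
* (β) `[K:ℚ] ≤ 8` (Ribet; gen 13 `GaloisOctic` for the Galois octic case),
* (γ) `[K:ℚ] = 16` and every Galois automorphism squares to `1` or to `c` (gen 15, `AbelianSixteen`).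

The direction ⟸ is gens 11/13/15 by name.  The direction ⟹ (`exists_isPrimitive_not_isNondegenerate_of_not_good`)
is NEW and holds in EVERY degree: by the atom-embedding theorem (part IIIb, `TwoGroupPieces.atom_cases`) a Galois
group failing (α)(β)(γ) contains one of six atoms through `c`, each of which carries a kernel-decided subgroup model
(parts IIa/IIb) inducing a PRIMITIVE DEGENERATE CM type (part I, subgroup induction + Yanai).  In every bad case a
SIMPLE CM abelian variety of dimension `2^n` with an exceptional Hodge class on some power exists
(`exists_simple_degenerate_of_not_good`); in every good case the Hodge conjecture holds for all powers of all simple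
CM abelian varieties with CM by `K` (`hodgeConjectureFor_pow_of_isSimple_of_good`), unconditionally.

## References

* [Shimura1998] G. Shimura, *Abelian Varieties with Complex Multiplication and Modular Functions*, §6.2 Thm. 3,
  §8.1, §8.2 Prop. 26.
* [Gordon1999HodgeAVSurvey] B. B. Gordon, *A survey of the Hodge conjecture for abelian varieties*, 5.13, Thm. 6.4,
  §9.4.3 (Theorem [B.140] = Yanai 1994).
* [Kubota1965] T. Kubota, *On the field extension by complex multiplication*, Trans. AMS 118 (1965), §4 Lemma 2.
* [Dodson1984] B. Dodson, *The structure of Galois groups of CM-fields*, Trans. AMS 283 (1984), §3.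
-/

noncomputable section

open CategoryTheory CategoryTheory.Limits NumberField

namespace Summit.HodgeConjecture.CorCM.AbelianTwoPowerClassification

open Literature.NumberTheory.ComplexMultiplication
open Literature.AlgebraicGeometry.Motives (AbelianVariety CMType)
open Literature.AlgebraicGeometry.HodgeTheory
open Literature.AlgebraicGeometry.ComplexMultiplication (IsCMTypeRealisation isSimple_iff_isPrimitive)
open Literature.AlgebraicGeometry.Pohlmann1968
open Literature.Barriers.HodgeConjecture (divisorClassesSpan)
open Summit.HodgeConjecture.CorCM.GaloisOctic (complexConj_restrictScalars_ne_one complexConj_mul_self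
  isNondegenerate_of_isPrimitive_of_finrank_le_ten)
open Summit.HodgeConjecture.CorCM.ThinKernel (isNondegenerate_of_isPrimitive_of_mem_zpowers)
open Summit.HodgeConjecture.CorCM.AbelianSixteen (isNondegenerate_of_isPrimitive_of_sq_eq_one_or_conj
  exists_simple_realisation_of_isPrimitive)
open Summit.HodgeConjecture.CorCM.TwoPowerAtoms
open Summit.HodgeConjecture.CorCM.TwoGroupPieces (atom_cases)

open scoped Classical

variable {K : Type} [Field K] [NumberField K] [IsCMField K] [IsGalois ℚ K]

/-! ## §1 The necessity: a field failing (α), (β), (γ) has a primitive degenerate CM type -/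

/-- **NECESSITY.**  `K` abelian CM of degree `2^{n+1}`; if complex conjugation lies in NO cyclic subgroup of index
`≤ 2`, `[K:ℚ] > 8`, and it is not the case that `[K:ℚ] = 16` with all squares in `{1, c}`, then `K` has a PRIMITIVE
DEGENERATE CM type (atom embedding + subgroup models + subgroup induction + Yanai).
[cite: Gordon1999HodgeAVSurvey, §9.4.3 (Theorem [B.140])] [cite: Shimura1998, §8.1, §8.2 Prop. 26] -/
theorem exists_isPrimitive_not_isNondegenerate_of_not_good (hcomm : ∀ g h : K ≃ₐ[ℚ] K, g * h = h * g) {n : ℕ}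
    (hK : Module.finrank ℚ K = 2 ^ (n + 1))
    (hα : ¬ ∃ z : K ≃ₐ[ℚ] K, (IsCMField.complexConj K).restrictScalars ℚ ∈ Subgroup.zpowers z ∧
      (Subgroup.zpowers z).index ≤ 2)
    (hβ : ¬ Module.finrank ℚ K ≤ 8)
    (hγ : ¬ (Module.finrank ℚ K = 16 ∧
      ∀ g : K ≃ₐ[ℚ] K, g * g = 1 ∨ g * g = (IsCMField.complexConj K).restrictScalars ℚ))
    (φ₀ : K →+* ℂ) : ∃ Φ : CMType K, IsPrimitive (ℂ ≃+* ℂ) Φ.1 φ₀ ∧ ¬ IsNondegenerate Φ := by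
  letI : CommGroup (K ≃ₐ[ℚ] K) := { (inferInstance : Group (K ≃ₐ[ℚ] K)) with mul_comm := hcomm }
  set c : K ≃ₐ[ℚ] K := (IsCMField.complexConj K).restrictScalars ℚ with hc_def
  -- the additive Galois group
  have hcardG : Fintype.card (K ≃ₐ[ℚ] K) = 2 ^ (n + 1) := by
    rw [Fintype.card_congr (Equiv.ofBijective (embOf φ₀) (embOf_bijective φ₀)), NumberField.Embeddings.card, hK]
  have hcard : Fintype.card (Additive (K ≃ₐ[ℚ] K)) = 2 ^ (n + 1) := by
    rw [← Fintype.card_congr (Additive.ofMul (α := K ≃ₐ[ℚ] K)), hcardG]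
  have hc0 : Additive.ofMul c ≠ 0 := fun h =>
    complexConj_restrictScalars_ne_one (K := K) (Additive.ofMul.injective h)
  have hc2 : 2 • Additive.ofMul c = 0 := by
    rw [← ofMul_pow, pow_two, hc_def, complexConj_mul_self, ofMul_one]
  have htoMul : ∀ {M : Type} [AddCommGroup M] (j : M →+ Additive (K ≃ₐ[ℚ] K)) (c₀ : M),
      j c₀ = Additive.ofMul c → Additive.toMul (j c₀) = c := fun j c₀ h => by rw [h, toMul_ofMul]
  rcases atom_cases hcard (Additive.ofMul c) hc0 hc2 with
    ⟨z, ⟨k, hk⟩, hz⟩ | h8 | ⟨h16, hsq⟩ | ⟨j, hj, hjc⟩ | ⟨j, hj, hjc⟩ | ⟨j, hj, hjc⟩ | ⟨j, hj, hjc⟩ |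
      ⟨j, hj, hjc⟩ | ⟨j, hj, hjc⟩
  · -- thin: contradicts (α)
    exfalso
    refine hα ⟨Additive.toMul z, ?_, ?_⟩
    · rw [Subgroup.mem_zpowers_iff]
      exact ⟨k, by rw [← toMul_zsmul, hk, toMul_ofMul]⟩
    · have h1 := (Subgroup.zpowers (Additive.toMul z)).index_mul_card
      rw [Nat.card_zpowers, ← addOrderOf_ofMul_eq_orderOf, ofMul_toMul, Nat.card_eq_fintype_card, hcardG] at h1
      rw [hcard] at hz
      have hpos : 0 < addOrderOf z := addOrderOf_pos z
      nlinarith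
  · exact absurd (by rw [hK, ← hcard]; exact h8) hβ
  · exfalso
    refine hγ ⟨by rw [hK, ← hcard, h16], fun g => ?_⟩
    rcases hsq (Additive.ofMul g) with h | h
    · left
      apply Additive.ofMul.injective
      rw [ofMul_mul, ← two_nsmul, h, ofMul_one]
    · right
      apply Additive.ofMul.injective
      rw [ofMul_mul, ← two_nsmul, h]
  · exact exists_isPrimitive_not_isNondegenerate_of_atom44 hcomm j hj (htoMul j _ hjc) φ₀
  · exact exists_isPrimitive_not_isNondegenerate_of_atom422 hcomm j hj (htoMul j _ hjc) φ₀
  · exact exists_isPrimitive_not_isNondegenerate_of_atom82 hcomm j hj (htoMul j _ hjc) φ₀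
  · exact exists_isPrimitive_not_isNondegenerate_of_atom22222 hcomm j hj (htoMul j _ hjc) φ₀
  · exact exists_isPrimitive_not_isNondegenerate_of_atom2224 hcomm j hj (htoMul j _ hjc) φ₀
  · exact exists_isPrimitive_not_isNondegenerate_of_atom228 hcomm j hj (htoMul j _ hjc) φ₀

/-! ## §2 The sufficiency (gens 11/13/15 by name) and the classification -/

/-- **SUFFICIENCY** (collecting gen 15's `ThinKernel.isNondegenerate_of_isPrimitive_of_mem_zpowers`, gen 13's
`GaloisOctic.isNondegenerate_of_isPrimitive_of_finrank_le_ten`, gen 15's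
`AbelianSixteen.isNondegenerate_of_isPrimitive_of_sq_eq_one_or_conj`): under (α), (β) or (γ) every primitive CM type
is nondegenerate. [cite: Kubota1965, §4 Lemma 2] [cite: Shimura1998, §8.2 Prop. 26] -/
theorem isNondegenerate_of_isPrimitive_of_good (hcomm : ∀ g h : K ≃ₐ[ℚ] K, g * h = h * g) {n : ℕ}
    (hK : Module.finrank ℚ K = 2 ^ (n + 1))
    (hgood : (∃ z : K ≃ₐ[ℚ] K, (IsCMField.complexConj K).restrictScalars ℚ ∈ Subgroup.zpowers z ∧
        (Subgroup.zpowers z).index ≤ 2) ∨ Module.finrank ℚ K ≤ 8 ∨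
      (Module.finrank ℚ K = 16 ∧ ∀ g : K ≃ₐ[ℚ] K, g * g = 1 ∨ g * g = (IsCMField.complexConj K).restrictScalars ℚ))
    {Φ : CMType K} (φ₀ : K →+* ℂ) (hprim : IsPrimitive (ℂ ≃+* ℂ) Φ.1 φ₀) : IsNondegenerate Φ := by
  rcases hgood with ⟨z, hcz, hidx⟩ | h8 | ⟨h16, hsq⟩
  · exact isNondegenerate_of_isPrimitive_of_mem_zpowers hcomm hK z hcz hidx φ₀ hprim
  · exact isNondegenerate_of_isPrimitive_of_finrank_le_ten (by omega) (fun _ => inferInstance) φ₀ hprim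
  · exact isNondegenerate_of_isPrimitive_of_sq_eq_one_or_conj hcomm h16 hsq φ₀ hprim

/-- **THE CLASSIFICATION (CM types).**  For an abelian CM field `K` of degree `2^{n+1}`: every primitive CM type
of `K` is nondegenerate **iff** (α) complex conjugation lies in a cyclic subgroup of `Gal(K/ℚ)` of index `≤ 2`, or
(β) `[K:ℚ] ≤ 8`, or (γ) `[K:ℚ] = 16` and all squares of Galois automorphisms lie in `{1, c}`.
[cite: Kubota1965, §4 Lemma 2] [cite: Gordon1999HodgeAVSurvey, §9.4.3 (Theorem [B.140])]
[cite: Shimura1998, §8.2 Prop. 26] -/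
theorem forall_isPrimitive_isNondegenerate_iff (hcomm : ∀ g h : K ≃ₐ[ℚ] K, g * h = h * g) {n : ℕ}
    (hK : Module.finrank ℚ K = 2 ^ (n + 1)) (φ₀ : K →+* ℂ) :
    (∀ Φ : CMType K, IsPrimitive (ℂ ≃+* ℂ) Φ.1 φ₀ → IsNondegenerate Φ) ↔
      ((∃ z : K ≃ₐ[ℚ] K, (IsCMField.complexConj K).restrictScalars ℚ ∈ Subgroup.zpowers z ∧
          (Subgroup.zpowers z).index ≤ 2) ∨ Module.finrank ℚ K ≤ 8 ∨
        (Module.finrank ℚ K = 16 ∧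
          ∀ g : K ≃ₐ[ℚ] K, g * g = 1 ∨ g * g = (IsCMField.complexConj K).restrictScalars ℚ)) := by
  constructor
  · intro h
    by_contra hbad
    obtain ⟨Φ, hprim, hdeg⟩ := exists_isPrimitive_not_isNondegenerate_of_not_good hcomm hK
      (fun hh => hbad (Or.inl hh)) (fun hh => hbad (Or.inr (Or.inl hh))) (fun hh => hbad (Or.inr (Or.inr hh))) φ₀
    exact hdeg (h Φ hprim)
  · intro hgood Φ hprim
    exact isNondegenerate_of_isPrimitive_of_good hcomm hK hgood φ₀ hprim

/-! ## §3 Simple CM abelian varieties: the classification, the Hodge conjecture in the good cases, exceptional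
classes in the bad cases -/

section Geometry

variable {Φ : CMType K} {A : AbelianVariety ℂ} {ι : 𝓞 K →+* End A} {θ : K →+* Module.End ℂ (complexBetti A.X 1)}

/-- **Good case: every SIMPLE abelian variety with CM by `K` realises a nondegenerate type** (`A` simple ⟺ `Φ`
primitive, Shimura §8.2 Prop. 26). [cite: Shimura1998, §8.2 Prop. 26] [cite: Kubota1965, §4 Lemma 2] -/
theorem isNondegenerate_of_isSimple_of_good (hcomm : ∀ g h : K ≃ₐ[ℚ] K, g * h = h * g) {n : ℕ}
    (hK : Module.finrank ℚ K = 2 ^ (n + 1))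
    (hgood : (∃ z : K ≃ₐ[ℚ] K, (IsCMField.complexConj K).restrictScalars ℚ ∈ Subgroup.zpowers z ∧
        (Subgroup.zpowers z).index ≤ 2) ∨ Module.finrank ℚ K ≤ 8 ∨
      (Module.finrank ℚ K = 16 ∧ ∀ g : K ≃ₐ[ℚ] K, g * g = 1 ∨ g * g = (IsCMField.complexConj K).restrictScalars ℚ))
    (hA : IsCMTypeRealisation Φ A ι θ) (hs : A.IsSimple) : IsNondegenerate Φ := by
  obtain ⟨φ₀⟩ := (inferInstance : Nonempty (K →+* ℂ))
  exact isNondegenerate_of_isPrimitive_of_good hcomm hK hgood φ₀ ((isSimple_iff_isPrimitive hA φ₀).1 hs)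

/-- **THE HODGE CONJECTURE FOR EVERY POWER OF EVERY SIMPLE ABELIAN VARIETY WITH COMPLEX MULTIPLICATION BY AN ABELIAN
CM FIELD OF `2`-POWER DEGREE SATISFYING (α), (β) OR (γ)** — unconditionally (no named fact; Hazama/Gordon 6.4 on the
nondegenerate type). [cite: Gordon1999HodgeAVSurvey, 5.13 (i) and Thm. 6.4] [cite: Kubota1965, §4 Lemma 2] -/
theorem hodgeConjectureFor_pow_of_isSimple_of_good (hcomm : ∀ g h : K ≃ₐ[ℚ] K, g * h = h * g) {n : ℕ}
    (hK : Module.finrank ℚ K = 2 ^ (n + 1))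
    (hgood : (∃ z : K ≃ₐ[ℚ] K, (IsCMField.complexConj K).restrictScalars ℚ ∈ Subgroup.zpowers z ∧
        (Subgroup.zpowers z).index ≤ 2) ∨ Module.finrank ℚ K ≤ 8 ∨
      (Module.finrank ℚ K = 16 ∧ ∀ g : K ≃ₐ[ℚ] K, g * g = 1 ∨ g * g = (IsCMField.complexConj K).restrictScalars ℚ))
    (hA : IsCMTypeRealisation Φ A ι θ) (hs : A.IsSimple) (N : ℕ) :
    HodgeConjectureFor (⨁ fun _ : Fin N => A).dim (⨁ fun _ : Fin N => A).X :=
  (isNondegenerate_of_isSimple_of_good hcomm hK hgood hA hs).hodgeConjectureFor_pow hA N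

/-- The Hodge conjecture for the simple abelian variety itself in the good cases.
[cite: Gordon1999HodgeAVSurvey, 5.13 (i)] -/
theorem hodgeConjectureFor_of_isSimple_of_good (hcomm : ∀ g h : K ≃ₐ[ℚ] K, g * h = h * g) {n : ℕ}
    (hK : Module.finrank ℚ K = 2 ^ (n + 1))
    (hgood : (∃ z : K ≃ₐ[ℚ] K, (IsCMField.complexConj K).restrictScalars ℚ ∈ Subgroup.zpowers z ∧
        (Subgroup.zpowers z).index ≤ 2) ∨ Module.finrank ℚ K ≤ 8 ∨
      (Module.finrank ℚ K = 16 ∧ ∀ g : K ≃ₐ[ℚ] K, g * g = 1 ∨ g * g = (IsCMField.complexConj K).restrictScalars ℚ))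
    (hA : IsCMTypeRealisation Φ A ι θ) (hs : A.IsSimple) : HodgeConjectureFor A.dim A.X :=
  (isNondegenerate_of_isSimple_of_good hcomm hK hgood hA hs).hodgeConjectureFor hA

/-- Every rational `(m,m)`-class on every power of such a simple abelian variety is a polynomial in divisor classes
(`Bᵐ ⊗ ℂ = Dᵐ ⊗ ℂ`). [cite: Gordon1999HodgeAVSurvey, 5.13 (i) and Thm. 6.4] -/
theorem mem_divisorClassesSpan_pow_of_isSimple_of_good (hcomm : ∀ g h : K ≃ₐ[ℚ] K, g * h = h * g) {n : ℕ}
    (hK : Module.finrank ℚ K = 2 ^ (n + 1))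
    (hgood : (∃ z : K ≃ₐ[ℚ] K, (IsCMField.complexConj K).restrictScalars ℚ ∈ Subgroup.zpowers z ∧
        (Subgroup.zpowers z).index ≤ 2) ∨ Module.finrank ℚ K ≤ 8 ∨
      (Module.finrank ℚ K = 16 ∧ ∀ g : K ≃ₐ[ℚ] K, g * g = 1 ∨ g * g = (IsCMField.complexConj K).restrictScalars ℚ))
    (hA : IsCMTypeRealisation Φ A ι θ) (hs : A.IsSimple) (N m : ℕ)
    {x : complexBetti (⨁ fun _ : Fin N => A).X (2 * m)} (hxQ : IsRationalClass x)
    (hxH : IsOfHodgeType (⨁ fun _ : Fin N => A).dim (⨁ fun _ : Fin N => A).X (2 * m) m m x) :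
    x ∈ divisorClassesSpan (⨁ fun _ : Fin N => A).X (⨁ fun _ : Fin N => A).dim m :=
  (isNondegenerate_of_isSimple_of_good hcomm hK hgood hA hs).mem_divisorClassesSpan_pow hA N m hxQ hxH

end Geometry

/-- **Bad case: a SIMPLE DEGENERATE CM abelian variety of dimension `2^n` exists**, with an exceptional Hodge class
— rational, of type `(m,m)`, outside the complexified divisor ring — on some power (Shimura's existence theorem =
tree `cmAbelianVarietyRealised_holds`; Hazama/Pohlmann `exists_exceptional_pow_of_not_isNondegenerate`).
[cite: Shimura1998, §6.2 Thm. 3 and §8.2 Prop. 26] [cite: Gordon1999HodgeAVSurvey, Thm. 6.4 and §9.4.3] -/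
theorem exists_simple_degenerate_of_not_good (hcomm : ∀ g h : K ≃ₐ[ℚ] K, g * h = h * g) {n : ℕ}
    (hK : Module.finrank ℚ K = 2 ^ (n + 1))
    (hα : ¬ ∃ z : K ≃ₐ[ℚ] K, (IsCMField.complexConj K).restrictScalars ℚ ∈ Subgroup.zpowers z ∧
      (Subgroup.zpowers z).index ≤ 2)
    (hβ : ¬ Module.finrank ℚ K ≤ 8)
    (hγ : ¬ (Module.finrank ℚ K = 16 ∧
      ∀ g : K ≃ₐ[ℚ] K, g * g = 1 ∨ g * g = (IsCMField.complexConj K).restrictScalars ℚ)) :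
    ∃ (Φ : CMType K) (φ₀ : K →+* ℂ) (A : AbelianVariety ℂ) (ι : 𝓞 K →+* End A)
      (θ : K →+* Module.End ℂ (complexBetti A.X 1)),
      IsPrimitive (ℂ ≃+* ℂ) Φ.1 φ₀ ∧ ¬ IsNondegenerate Φ ∧ IsCMTypeRealisation Φ A ι θ ∧ A.IsSimple ∧
      A.dim = 2 ^ n ∧
      ∃ N m : ℕ, ∃ x : complexBetti (⨁ fun _ : Fin N => A).X (2 * m), IsRationalClass x ∧
        IsOfHodgeType (⨁ fun _ : Fin N => A).dim (⨁ fun _ : Fin N => A).X (2 * m) m m x ∧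
        x ∉ divisorClassesSpan (⨁ fun _ : Fin N => A).X (⨁ fun _ : Fin N => A).dim m := by
  obtain ⟨φ₀⟩ := (inferInstance : Nonempty (K →+* ℂ))
  obtain ⟨Φ, hprim, hdeg⟩ := exists_isPrimitive_not_isNondegenerate_of_not_good hcomm hK hα hβ hγ φ₀
  obtain ⟨A, ι, θ, hA, hs, hdim⟩ := exists_simple_realisation_of_isPrimitive Φ φ₀ hprim
  refine ⟨Φ, φ₀, A, ι, θ, hprim, hdeg, hA, hs, ?_, exists_exceptional_pow_of_not_isNondegenerate φ₀ hprim hdeg hA⟩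
  rw [hdim, hK, pow_succ, Nat.mul_div_cancel _ (by norm_num : 0 < 2)]

/-- **Degree `≥ 32`: thin is necessary.**  An abelian CM field of `2`-power degree `≥ 32` in which complex
conjugation lies in no cyclic subgroup of index `≤ 2` (i.e. `K` is cyclic neither over `ℚ` nor over a real
quadratic field) carries a SIMPLE DEGENERATE CM abelian variety of dimension `[K:ℚ]/2` with an exceptional Hodge
class on some power — the sequel announced by gen 15 ("`|G| ≥ 32` necessity").
[cite: Shimura1998, §6.2 Thm. 3 and §8.2 Prop. 26] [cite: Gordon1999HodgeAVSurvey, Thm. 6.4 and §9.4.3] -/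
theorem exists_simple_degenerate_of_not_thin_of_le_finrank (hcomm : ∀ g h : K ≃ₐ[ℚ] K, g * h = h * g) {n : ℕ}
    (hK : Module.finrank ℚ K = 2 ^ (n + 1)) (h32 : 32 ≤ Module.finrank ℚ K)
    (hα : ¬ ∃ z : K ≃ₐ[ℚ] K, (IsCMField.complexConj K).restrictScalars ℚ ∈ Subgroup.zpowers z ∧
      (Subgroup.zpowers z).index ≤ 2) :
    ∃ (Φ : CMType K) (φ₀ : K →+* ℂ) (A : AbelianVariety ℂ) (ι : 𝓞 K →+* End A)
      (θ : K →+* Module.End ℂ (complexBetti A.X 1)),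
      IsPrimitive (ℂ ≃+* ℂ) Φ.1 φ₀ ∧ ¬ IsNondegenerate Φ ∧ IsCMTypeRealisation Φ A ι θ ∧ A.IsSimple ∧
      A.dim = 2 ^ n ∧
      ∃ N m : ℕ, ∃ x : complexBetti (⨁ fun _ : Fin N => A).X (2 * m), IsRationalClass x ∧
        IsOfHodgeType (⨁ fun _ : Fin N => A).dim (⨁ fun _ : Fin N => A).X (2 * m) m m x ∧
        x ∉ divisorClassesSpan (⨁ fun _ : Fin N => A).X (⨁ fun _ : Fin N => A).dim m :=
  exists_simple_degenerate_of_not_good hcomm hK hα (by omega) (by omega)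


/-- **THE CLASSIFICATION (simple abelian varieties).**  For an abelian CM field `K` of degree `2^{n+1}`: every
SIMPLE abelian variety with complex multiplication by `K` is nondegenerate — `Hdg = Div` on all its powers, the Hodge
conjecture for all its powers — **iff** (α) ∨ (β) ∨ (γ); otherwise simple degenerate ones with exceptional Hodge
classes exist. [cite: Shimura1998, §6.2 Thm. 3 and §8.2 Prop. 26] [cite: Kubota1965, §4 Lemma 2]
[cite: Gordon1999HodgeAVSurvey, §9.4.3 (Theorem [B.140])] -/
theorem forall_isSimple_isNondegenerate_iff (hcomm : ∀ g h : K ≃ₐ[ℚ] K, g * h = h * g) {n : ℕ}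
    (hK : Module.finrank ℚ K = 2 ^ (n + 1)) :
    (∀ (Φ : CMType K) (A : AbelianVariety ℂ) (ι : 𝓞 K →+* End A) (θ : K →+* Module.End ℂ (complexBetti A.X 1)),
        IsCMTypeRealisation Φ A ι θ → A.IsSimple → IsNondegenerate Φ) ↔
      ((∃ z : K ≃ₐ[ℚ] K, (IsCMField.complexConj K).restrictScalars ℚ ∈ Subgroup.zpowers z ∧
          (Subgroup.zpowers z).index ≤ 2) ∨ Module.finrank ℚ K ≤ 8 ∨
        (Module.finrank ℚ K = 16 ∧
          ∀ g : K ≃ₐ[ℚ] K, g * g = 1 ∨ g * g = (IsCMField.complexConj K).restrictScalars ℚ)) := by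
  constructor
  · intro h
    by_contra hbad
    obtain ⟨Φ, φ₀, A, ι, θ, -, hdeg, hA, hs, -⟩ := exists_simple_degenerate_of_not_good hcomm hK
      (fun hh => hbad (Or.inl hh)) (fun hh => hbad (Or.inr (Or.inl hh))) (fun hh => hbad (Or.inr (Or.inr hh)))
    exact hdeg (h Φ A ι θ hA hs)
  · intro hgood Φ A ι θ hA hs
    exact isNondegenerate_of_isSimple_of_good hcomm hK hgood hA hs


/-! ## §4 The thin alternative (α) in field-theoretic terms: `K` cyclic over `ℚ` or over a real quadratic field -/

/-- **(α) ⟺ `K` is cyclic over a totally real subfield of degree `≤ 2`.**  Complex conjugation lies in a cyclic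
subgroup of `Gal(K/ℚ)` of index `≤ 2` iff there is an intermediate field `L`, `[L:ℚ] ≤ 2`, fixed pointwise by
complex conjugation (so `L = ℚ` or a REAL quadratic field), with `Gal(K/L)` cyclic (Galois correspondence).
[cite: Shimura1998, §8.1] -/
theorem thin_iff_exists_isCyclic_over_real :
    (∃ z : K ≃ₐ[ℚ] K, (IsCMField.complexConj K).restrictScalars ℚ ∈ Subgroup.zpowers z ∧
        (Subgroup.zpowers z).index ≤ 2) ↔
      ∃ L : IntermediateField ℚ K, Module.finrank ℚ L ≤ 2 ∧ (∀ x ∈ L, IsCMField.complexConj K x = x) ∧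
        IsCyclic (K ≃ₐ[L] K) := by
  constructor
  · rintro ⟨z, hcz, hidx⟩
    set H := Subgroup.zpowers z with hH
    set L := IntermediateField.fixedField H with hL
    have hfix : L.fixingSubgroup = H := IntermediateField.fixingSubgroup_fixedField H
    refine ⟨L, ?_, fun x hx => ?_, ?_⟩
    · have h1 : Module.finrank ℚ L * Module.finrank L K = Module.finrank ℚ K := Module.finrank_mul_finrank ℚ L K
      have h2 : Module.finrank L K = Nat.card H := IntermediateField.finrank_fixedField_eq_card H
      have h3 := H.index_mul_card
      rw [IsGalois.card_aut_eq_finrank, ← h1, ← h2] at h3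
      have hpos : 0 < Module.finrank L K := Module.finrank_pos
      have : H.index = Module.finrank ℚ L := Nat.eq_of_mul_eq_mul_right hpos h3
      omega
    · rw [hL, IntermediateField.mem_fixedField_iff] at hx
      have := hx _ hcz
      rwa [AlgEquiv.restrictScalars_apply] at this
    · haveI : IsCyclic L.fixingSubgroup := by rw [hfix]; infer_instance
      exact isCyclic_of_surjective _ (IntermediateField.fixingSubgroupEquiv L).surjective
  · rintro ⟨L, hL, hLreal, hcyc⟩
    haveI : IsCyclic L.fixingSubgroup :=
      isCyclic_of_surjective _ (IntermediateField.fixingSubgroupEquiv L).symm.surjective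
    obtain ⟨z₀, hz₀⟩ := IsCyclic.exists_generator (α := L.fixingSubgroup)
    have hZ : Subgroup.zpowers (z₀ : K ≃ₐ[ℚ] K) = L.fixingSubgroup := by
      refine le_antisymm ((Subgroup.zpowers_le).2 z₀.2) fun x hx => ?_
      obtain ⟨k, hk⟩ := Subgroup.mem_zpowers_iff.1 (hz₀ ⟨x, hx⟩)
      exact Subgroup.mem_zpowers_iff.2 ⟨k, by rw [← Subgroup.coe_zpow, hk]⟩
    refine ⟨z₀, ?_, ?_⟩
    · rw [hZ, IntermediateField.mem_fixingSubgroup_iff]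
      intro x hx
      rw [AlgEquiv.restrictScalars_apply]
      exact hLreal x hx
    · rw [hZ]
      have h1 := L.fixingSubgroup.index_mul_card
      rw [IsGalois.card_fixingSubgroup_eq_finrank L, IsGalois.card_aut_eq_finrank,
        ← Module.finrank_mul_finrank ℚ L K] at h1
      have hpos : 0 < Module.finrank L K := Module.finrank_pos
      have : L.fixingSubgroup.index = Module.finrank ℚ L := Nat.eq_of_mul_eq_mul_right hpos h1
      omega

/-- **THE CLASSIFICATION in field-theoretic terms.**  For an abelian CM field `K` of degree `2^{n+1}`: every
SIMPLE abelian variety with complex multiplication by `K` is nondegenerate **iff** `K` is cyclic over `ℚ` or over a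
real quadratic subfield, or `[K:ℚ] ≤ 8`, or `[K:ℚ] = 16` and every Galois automorphism squares to `1` or to complex
conjugation. [cite: Shimura1998, §6.2 Thm. 3 and §8.2 Prop. 26] [cite: Kubota1965, §4 Lemma 2]
[cite: Gordon1999HodgeAVSurvey, §9.4.3 (Theorem [B.140])] -/
theorem forall_isSimple_isNondegenerate_iff_isCyclic_over_real (hcomm : ∀ g h : K ≃ₐ[ℚ] K, g * h = h * g)
    {n : ℕ} (hK : Module.finrank ℚ K = 2 ^ (n + 1)) :
    (∀ (Φ : CMType K) (A : AbelianVariety ℂ) (ι : 𝓞 K →+* End A) (θ : K →+* Module.End ℂ (complexBetti A.X 1)),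
        IsCMTypeRealisation Φ A ι θ → A.IsSimple → IsNondegenerate Φ) ↔
      ((∃ L : IntermediateField ℚ K, Module.finrank ℚ L ≤ 2 ∧ (∀ x ∈ L, IsCMField.complexConj K x = x) ∧
          IsCyclic (K ≃ₐ[L] K)) ∨ Module.finrank ℚ K ≤ 8 ∨
        (Module.finrank ℚ K = 16 ∧
          ∀ g : K ≃ₐ[ℚ] K, g * g = 1 ∨ g * g = (IsCMField.complexConj K).restrictScalars ℚ)) := by
  rw [forall_isSimple_isNondegenerate_iff hcomm hK, thin_iff_exists_isCyclic_over_real]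

/-- **Degree `≥ 32`: nondegeneracy of all simple CM abelian varieties ⟺ `K` cyclic over `ℚ` or over a real
quadratic field** (the alternatives (β), (γ) are void). [cite: Shimura1998, §8.2 Prop. 26]
[cite: Kubota1965, §4 Lemma 2] [cite: Gordon1999HodgeAVSurvey, §9.4.3 (Theorem [B.140])] -/
theorem forall_isSimple_isNondegenerate_iff_isCyclic_over_real_of_le_finrank
    (hcomm : ∀ g h : K ≃ₐ[ℚ] K, g * h = h * g) {n : ℕ} (hK : Module.finrank ℚ K = 2 ^ (n + 1))
    (h32 : 32 ≤ Module.finrank ℚ K) :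
    (∀ (Φ : CMType K) (A : AbelianVariety ℂ) (ι : 𝓞 K →+* End A) (θ : K →+* Module.End ℂ (complexBetti A.X 1)),
        IsCMTypeRealisation Φ A ι θ → A.IsSimple → IsNondegenerate Φ) ↔
      ∃ L : IntermediateField ℚ K, Module.finrank ℚ L ≤ 2 ∧ (∀ x ∈ L, IsCMField.complexConj K x = x) ∧
        IsCyclic (K ≃ₐ[L] K) := by
  rw [forall_isSimple_isNondegenerate_iff_isCyclic_over_real hcomm hK]
  constructor
  · rintro (h | h | h)
    · exact h
    · omega
    · omega
  · exact Or.inl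


end Summit.HodgeConjecture.CorCM.AbelianTwoPowerClassification

end
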